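import Summits.QuantumFields.YangMills.Theorems.LuscherReductionOneSiteLevelsGnPotDerivH

/-!
# `⟨Ψ, K_B Ψ⟩` and `‖Ψ‖²` for gnomonic pull-backs `Ψ = G ∘ gnCoord μ`, as integrals over the zero-mode space
# (support module for the registered stub `stub_absLower` of crux `OneSiteLevels`, route `LuscherReduction`,
# item stmt-QuantumFields-20007; fleet seat prover ym-luscher-20007-p2)

For a bounded measurable `G : ZM → ℝ` and `Ψ(U) = G(gnCoord μ U)`:
* `l2_gnPullback` — `‖Ψ‖² = 8 ∫ gnDensityReal μ · G²`, with the window bounds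
  `8c(1 − 6μ²r²)∫G² ≤ ‖Ψ‖² ≤ 8c ∫G²`, `c = μ⁹(2π²)⁻³`, when `supp G ⊆ B(0,r)`;
* `configMeasure_prod_eq_sum` — the product of two one-site a-priori measures as a sum over the `64` pairs of hemisphere
  patterns of push-forwards of `(ρ ⊗ ρ)·Lebesgue(ZM × ZM)`;
* `qform_gnPullback_eq_sum` — `⟨Ψ,K_BΨ⟩ = Σ_{σ,σ'} T_{σσ'}`, `T_{σσ'} = ∫ ρ(y)ρ(y') G(y) K_B(gnChart σ y, gnChart σ' y') G(y') d(y,y')`;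
* `gnPairTerm_diag_eq` (all diagonal terms agree), `abs_gnPairTerm_offdiag_le` (`|T_{σσ'}| ≤ e^{9B/4}∫ρG²/8` for `σ ≠ σ'`
  inside the window `μ²r² ≤ 1/16`), hence `qform_gnPullback_ge`: `⟨Ψ,K_BΨ⟩ ≥ 8·T_{σ₀σ₀} − 7e^{9B/4}∫ρG²`.

## WHAT THIS IS NOT
Measure-theoretic bookkeeping; NOT the stub, NOT THE CLAY GAP.  Sorry-free, no named fact.
-/

set_option autoImplicit false

noncomputable section

open MeasureTheory Filter Topology Real
open scoped Matrix ENNReal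
open Literature.MathematicalPhysics.QuantumFieldTheory
open Literature.MathematicalPhysics.QuantumLattice
open Literature.Analysis.OperatorTheory.YMMatrixModel

namespace Summit.QuantumFields.YangMills.Theorems.FemtoTransferGap

/-! ### §1. `‖Ψ‖²` -/

section L2

variable {μ : ℝ} {G : ZM → ℝ}

/-- The total mass of the chart density: `∫ gnDensityReal μ = 1/8`. [folklore] -/
theorem integral_gnDensityReal (hμ : 0 < μ) : ∫ y, gnDensityReal μ y = 1 / 8 := by
  have h := integral_gnPullback hμ (G := fun _ => (1:ℝ)) measurable_const ⟨1, fun _ => by simp⟩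
  simp only [mul_one, integral_const, probReal_univ, smul_eq_mul] at h
  linarith

/-- The chart density is integrable. [folklore] -/
theorem integrable_gnDensityReal (hμ : 0 < μ) : Integrable (gnDensityReal μ) := by
  refine Integrable.of_integral_ne_zero ?_
  rw [integral_gnDensityReal hμ]; norm_num

/-- **`‖Ψ‖² = 8 ∫ ρ G²`** for `Ψ = G ∘ gnCoord μ`, `G` bounded measurable. [folklore] -/
theorem l2_gnPullback (hμ : 0 < μ) (hG : Measurable G) (hb : ∃ C : ℝ, ∀ x, |G x| ≤ C) :
    l2 (fun U : Cfg => G (gnCoord μ U)) (fun U => G (gnCoord μ U)) = 8 * ∫ y, gnDensityReal μ y * G y ^ 2 := by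
  unfold l2
  obtain ⟨C, hC⟩ := hb
  have h := integral_gnPullback hμ (G := fun x => G x ^ 2) (hG.pow_const 2)
    ⟨C ^ 2, fun x => by rw [abs_pow]; exact pow_le_pow_left₀ (abs_nonneg _) (hC x) 2⟩
  simp only [sq] at h ⊢
  exact h

/-- Upper bound: `‖Ψ‖² ≤ 8 μ⁹ (2π²)⁻³ ∫ G²` (`G²` integrable). [folklore] -/
theorem l2_gnPullback_le (hμ : 0 < μ) (hG : Measurable G) (hb : ∃ C : ℝ, ∀ x, |G x| ≤ C) (hi : Integrable fun y => G y ^ 2) :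
    l2 (fun U : Cfg => G (gnCoord μ U)) (fun U => G (gnCoord μ U)) ≤ 8 * (μ ^ 9 * ((2 * π ^ 2)⁻¹) ^ 3) * ∫ y, G y ^ 2 := by
  rw [l2_gnPullback hμ hG hb]
  have h : ∫ y, gnDensityReal μ y * G y ^ 2 ≤ ∫ y, μ ^ 9 * ((2 * π ^ 2)⁻¹) ^ 3 * G y ^ 2 :=
    integral_mono_of_nonneg (ae_of_all _ fun y => mul_nonneg (gnDensityReal_pos hμ y).le (sq_nonneg _)) (hi.const_mul _)
      (ae_of_all _ fun y => mul_le_mul_of_nonneg_right (gnDensityReal_le hμ y) (sq_nonneg _))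
  rw [integral_const_mul] at h
  linarith

/-- `ρ G²` is integrable when `G²` is. [folklore] -/
theorem integrable_gnDensityReal_mul_sq (hμ : 0 < μ) (hG : Measurable G) (hi : Integrable fun y => G y ^ 2) :
    Integrable fun y => gnDensityReal μ y * G y ^ 2 := by
  refine (hi.const_mul (μ ^ 9 * ((2 * π ^ 2)⁻¹) ^ 3)).mono' ((measurable_gnDensityReal μ).mul (hG.pow_const 2)).aestronglyMeasurable
    (ae_of_all _ fun y => ?_)
  rw [Real.norm_eq_abs, abs_mul, abs_of_nonneg (gnDensityReal_pos hμ y).le, abs_of_nonneg (sq_nonneg _)]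
  exact mul_le_mul_of_nonneg_right (gnDensityReal_le hμ y) (sq_nonneg _)

/-- Lower bound on the density in the ball `‖y‖ ≤ r`: `ρ(y) ≥ μ⁹(2π²)⁻³(1 − 6μ²r²)`. [folklore] -/
theorem gnDensityReal_ge_of_norm_le {μ : ℝ} (hμ : 0 < μ) {y : ZM} {r : ℝ} (hy : ‖y‖ ≤ r) :
    μ ^ 9 * ((2 * π ^ 2)⁻¹) ^ 3 * (1 - 6 * (μ ^ 2 * r ^ 2)) ≤ gnDensityReal μ y := by
  rw [gnDensityReal_eq]
  refine mul_le_mul_of_nonneg_left ?_ (by positivity)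
  refine le_trans ?_ (one_sub_le_prod_gnC_sq μ y)
  have : ‖y‖ ^ 2 ≤ r ^ 2 := pow_le_pow_left₀ (norm_nonneg _) hy 2
  nlinarith [sq_nonneg μ]

/-- Lower bound in the window: if `G` vanishes outside `‖y‖ ≤ r`, then `8μ⁹(2π²)⁻³(1 − 6μ²r²)∫G² ≤ ‖Ψ‖²`. [folklore] -/
theorem le_l2_gnPullback (hμ : 0 < μ) (hG : Measurable G) (hb : ∃ C : ℝ, ∀ x, |G x| ≤ C) (hi : Integrable fun y => G y ^ 2)
    {r : ℝ} (hsupp : ∀ y, G y ≠ 0 → ‖y‖ ≤ r) :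
    8 * (μ ^ 9 * ((2 * π ^ 2)⁻¹) ^ 3 * (1 - 6 * (μ ^ 2 * r ^ 2))) * ∫ y, G y ^ 2 ≤
      l2 (fun U : Cfg => G (gnCoord μ U)) (fun U => G (gnCoord μ U)) := by
  rw [l2_gnPullback hμ hG hb]
  have h : ∫ y, μ ^ 9 * ((2 * π ^ 2)⁻¹) ^ 3 * (1 - 6 * (μ ^ 2 * r ^ 2)) * G y ^ 2 ≤ ∫ y, gnDensityReal μ y * G y ^ 2 := by
    refine integral_mono (hi.const_mul _) (integrable_gnDensityReal_mul_sq hμ hG hi) fun y => ?_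
    by_cases h0 : G y = 0
    · simp [h0]
    · exact mul_le_mul_of_nonneg_right (gnDensityReal_ge_of_norm_le hμ (hsupp y h0)) (sq_nonneg _)
  rw [integral_const_mul] at h
  linarith

end L2

/-! ### §2. `⟨Ψ, K_B Ψ⟩` as a sum over pairs of hemisphere patterns -/

section QForm

variable {μ : ℝ}

/-- The density on `ZM × ZM`. [folklore] -/
def gnDensity₂ (μ : ℝ) (q : ZM × ZM) : ℝ≥0∞ := gnDensity μ q.1 * gnDensity μ q.2

/-- `gnDensity₂` is measurable. [folklore] -/
theorem measurable_gnDensity₂ (μ : ℝ) : Measurable (gnDensity₂ μ) :=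
  ((measurable_gnDensity μ).comp measurable_fst).mul ((measurable_gnDensity μ).comp measurable_snd)

/-- The pair chart `(y,y') ↦ (gnChart μ σ y, gnChart μ σ' y')`. [folklore] -/
def gnPairChart (μ : ℝ) (σσ' : (Fin 3 → Bool) × (Fin 3 → Bool)) : ZM × ZM → Cfg × Cfg :=
  Prod.map (gnChart μ σσ'.1) (gnChart μ σσ'.2)

/-- The pair chart is measurable. [folklore] -/
theorem measurable_gnPairChart (μ : ℝ) (σσ' : (Fin 3 → Bool) × (Fin 3 → Bool)) : Measurable (gnPairChart μ σσ') :=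
  (measurable_gnChart μ σσ'.1).prodMap (measurable_gnChart μ σσ'.2)

/-- **The product of two one-site a-priori measures in the gnomonic chart**:
`σ^{⊗3} ⊗ σ^{⊗3} = Σ_{(σ,σ')} ((ρ⊗ρ)·Lebesgue(ZM×ZM)) ∘ (gnPairChart μ (σ,σ'))⁻¹`. [folklore] -/
theorem configMeasure_prod_eq_sum (hμ : 0 < μ) :
    (configMeasure SU2 1).prod (configMeasure SU2 1) = Measure.sum fun σσ' : (Fin 3 → Bool) × (Fin 3 → Bool) =>
      (((volume : Measure ZM).prod (volume : Measure ZM)).withDensity (gnDensity₂ μ)).map (gnPairChart μ σσ') := by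
  have hfin : IsFiniteMeasure ((volume : Measure ZM).withDensity (gnDensity μ)) := by
    refine ⟨?_⟩
    rw [withDensity_apply _ MeasurableSet.univ, Measure.restrict_univ]
    have h := lintegral_configMeasure_eq_sum_gnChart hμ (g := fun _ => (1 : ℝ≥0∞)) measurable_const
    simp only [one_mul, lintegral_const, measure_univ, Finset.sum_const, Finset.card_univ] at h
    calc ∫⁻ y, gnDensity μ y ≤ Fintype.card (Fin 3 → Bool) • ∫⁻ y, gnDensity μ y := by
          rw [nsmul_eq_mul]; exact le_mul_of_one_le_left bot_le (by exact_mod_cast Fintype.card_pos)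
      _ = 1 := h.symm
      _ < ⊤ := ENNReal.one_lt_top
  rw [configMeasure_su2_one_eq_sum_gnChart hμ, Measure.prod_sum]
  congr 1
  funext σσ'
  rw [Measure.map_prod_map _ _ (measurable_gnChart μ σσ'.1) (measurable_gnChart μ σσ'.2),
    prod_withDensity (measurable_gnDensity μ) (measurable_gnDensity μ)]
  rfl

variable {B : ℝ} {G : ZM → ℝ}

/-- The pair term `T_{σσ'} = ∫ ρ(y)ρ(y') G(y) K_B(gnChart σ y, gnChart σ' y') G(y') d(y,y')`. [folklore] -/
def gnPairTerm (B μ : ℝ) (G : ZM → ℝ) (σσ' : (Fin 3 → Bool) × (Fin 3 → Bool)) : ℝ :=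
  ∫ q : ZM × ZM, (gnDensityReal μ q.1 * gnDensityReal μ q.2) *
    (G q.1 * transferKernel su2Rep B (gnChart μ σσ'.1 q.1) (gnChart μ σσ'.2 q.2) * G q.2) ∂((volume : Measure ZM).prod volume)

/-- **`⟨Ψ, K_B Ψ⟩ = Σ_{σ,σ'} T_{σσ'}`** for `Ψ = G ∘ gnCoord μ`, `G` bounded measurable and colour-invariant (so that `Ψ` is physical),
`B ≥ 0`, `μ > 0`. [folklore] -/
theorem qform_gnPullback_eq_sum (hμ : 0 < μ) (hB : 0 ≤ B) (hG : Measurable G) (hb : ∃ C : ℝ, ∀ x, |G x| ≤ C)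
    (hinv : IsGaugeInv G) :
    qform su2Rep B (fun U : Cfg => G (gnCoord μ U)) (fun U => G (gnCoord μ U)) =
      ∑ σσ' : (Fin 3 → Bool) × (Fin 3 → Bool), gnPairTerm B μ G σσ' := by
  have hphys : IsPhys (fun U : Cfg => G (gnCoord μ U)) := isPhys_gnPullback hG hb hinv μ
  obtain ⟨C, hC⟩ := hb
  set F : Cfg × Cfg → ℝ := fun p => G (gnCoord μ p.1) * transferKernel su2Rep B p.1 p.2 * G (gnCoord μ p.2) with hF
  have hFm : Measurable F := ((hphys.measurable.comp measurable_fst).mul (measurable_transferKernel_su2 B)).mul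
    (hphys.measurable.comp measurable_snd)
  have hFi : Integrable F ((configMeasure SU2 1).prod (configMeasure SU2 1)) :=
    integrable_sandwich' (measurable_transferKernel_su2 B) (abs_transferKernel_le hB) hphys.measurable hphys.measurable
      (fun U => hC _) (fun V => hC _)
  rw [qform_eq_integral_cfgProd hB hphys]
  change ∫ p, F p ∂(configMeasure SU2 1).prod (configMeasure SU2 1) = _
  rw [configMeasure_prod_eq_sum hμ] at hFi ⊢
  rw [integral_sum_measure hFi, tsum_fintype]
  refine Finset.sum_congr rfl fun σσ' _ => ?_
  rw [integral_map (measurable_gnPairChart μ σσ').aemeasurable hFm.aestronglyMeasurable,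
    integral_withDensity_eq_integral_toReal_smul (measurable_gnDensity₂ μ)
      (ae_of_all _ fun q => by unfold gnDensity₂; rw [gnDensity_eq, gnDensity_eq]; exact ENNReal.mul_lt_top ENNReal.ofReal_lt_top ENNReal.ofReal_lt_top)]
  unfold gnPairTerm
  refine integral_congr_ae (ae_of_all _ fun q => ?_)
  show (gnDensity₂ μ q).toReal • F (gnPairChart μ σσ' q) = _
  rw [gnDensity₂, gnDensity_eq, gnDensity_eq, ENNReal.toReal_mul, ENNReal.toReal_ofReal (gnDensityReal_pos hμ _).le,
    ENNReal.toReal_ofReal (gnDensityReal_pos hμ _).le, smul_eq_mul, hF]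
  simp only [gnPairChart, Prod.map_fst, Prod.map_snd, gnCoord_gnChart hμ.ne']

/-- **All diagonal pair terms agree.** [folklore] -/
theorem gnPairTerm_diag_eq (B μ : ℝ) (G : ZM → ℝ) (σ σ₀ : Fin 3 → Bool) :
    gnPairTerm B μ G (σ, σ) = gnPairTerm B μ G (σ₀, σ₀) := by
  unfold gnPairTerm
  refine integral_congr_ae (ae_of_all _ fun q => ?_)
  simp only
  rw [transferKernel_gnChart_same_eq B μ σ σ₀]

/-- `∫ ρ(y) G(y)² ρ(y') d(y,y') = (∫ρG²)·(1/8)` and the symmetric version. [folklore] -/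
theorem integral_prod_density_sq (hμ : 0 < μ) (G : ZM → ℝ) :
    (∫ q : ZM × ZM, gnDensityReal μ q.1 * G q.1 ^ 2 * gnDensityReal μ q.2 ∂((volume : Measure ZM).prod volume)) =
      (∫ y, gnDensityReal μ y * G y ^ 2) * (1 / 8) := by
  rw [← integral_gnDensityReal hμ, ← integral_prod_mul]

/-- **Off-diagonal pair terms are small in the window**: if `σ ≠ σ'`, `B ≥ 0`, `G` vanishes outside `‖y‖ ≤ r` with `μ²r² ≤ 1/16`
and `G²` is integrable, then `|T_{σσ'}| ≤ e^{9B/4} · (∫ρG²)/8`. [folklore] -/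
theorem abs_gnPairTerm_offdiag_le (hμ : 0 < μ) (hB : 0 ≤ B) (hG : Measurable G) (hi : Integrable fun y => G y ^ 2)
    {r : ℝ} (hsupp : ∀ y, G y ≠ 0 → ‖y‖ ≤ r) (hr : μ ^ 2 * r ^ 2 ≤ 1 / 16) {σ σ' : Fin 3 → Bool} (hσ : σ ≠ σ') :
    |gnPairTerm B μ G (σ, σ')| ≤ Real.exp (9 / 4 * B) * ((∫ y, gnDensityReal μ y * G y ^ 2) / 8) := by
  have hwin : ∀ y, G y ≠ 0 → ∀ i, μ ^ 2 * csq i y ≤ 1 / 16 := by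
    intro y hy i
    have h1 : csq i y ≤ ‖y‖ ^ 2 := csq_le_norm_sq y i
    have h2 : ‖y‖ ^ 2 ≤ r ^ 2 := pow_le_pow_left₀ (norm_nonneg _) (hsupp y hy) 2
    nlinarith [sq_nonneg μ]
  -- the dominating function `e^{9B/4} ρρ' (G² + G'²)/2`
  set D : ZM × ZM → ℝ := fun q => Real.exp (9 / 4 * B) *
    ((gnDensityReal μ q.1 * G q.1 ^ 2 * gnDensityReal μ q.2 + gnDensityReal μ q.1 * (gnDensityReal μ q.2 * G q.2 ^ 2)) / 2) with hD
  have hρi := integrable_gnDensityReal hμ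
  have hρG := integrable_gnDensityReal_mul_sq hμ hG hi
  have hI1 : Integrable (fun q : ZM × ZM => gnDensityReal μ q.1 * G q.1 ^ 2 * gnDensityReal μ q.2) (volume.prod volume) :=
    hρG.mul_prod hρi
  have hI2 : Integrable (fun q : ZM × ZM => gnDensityReal μ q.1 * (gnDensityReal μ q.2 * G q.2 ^ 2)) (volume.prod volume) :=
    hρi.mul_prod hρG
  have hDi : Integrable D (volume.prod volume) := ((hI1.add hI2).div_const 2).const_mul _
  have hpt : ∀ q : ZM × ZM, |(gnDensityReal μ q.1 * gnDensityReal μ q.2) *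
      (G q.1 * transferKernel su2Rep B (gnChart μ σ q.1) (gnChart μ σ' q.2) * G q.2)| ≤ D q := by
    intro q
    have hρ1 := (gnDensityReal_pos hμ q.1).le; have hρ2 := (gnDensityReal_pos hμ q.2).le
    have hK0 := (transferKernel_pos su2Rep B (gnChart μ σ q.1) (gnChart μ σ' q.2)).le
    by_cases h1 : G q.1 = 0
    · rw [h1]; simp only [zero_mul, mul_zero, abs_zero]; rw [hD]; positivity
    by_cases h2 : G q.2 = 0
    · rw [h2]; simp only [mul_zero, abs_zero]; rw [hD]; positivity
    have hK : transferKernel su2Rep B (gnChart μ σ q.1) (gnChart μ σ' q.2) ≤ Real.exp (9 / 4 * B) :=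
      transferKernel_gnChart_ne_le hB hσ (hwin q.1 h1) (hwin q.2 h2)
    rw [abs_mul, abs_of_nonneg (mul_nonneg hρ1 hρ2), abs_mul, abs_mul, abs_of_nonneg hK0]
    have hGG : |G q.1| * |G q.2| ≤ (G q.1 ^ 2 + G q.2 ^ 2) / 2 := by
      nlinarith [sq_nonneg (|G q.1| - |G q.2|), sq_abs (G q.1), sq_abs (G q.2)]
    calc gnDensityReal μ q.1 * gnDensityReal μ q.2 * (|G q.1| * transferKernel su2Rep B (gnChart μ σ q.1) (gnChart μ σ' q.2) * |G q.2|)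
        = gnDensityReal μ q.1 * gnDensityReal μ q.2 * transferKernel su2Rep B (gnChart μ σ q.1) (gnChart μ σ' q.2) * (|G q.1| * |G q.2|) := by ring
      _ ≤ gnDensityReal μ q.1 * gnDensityReal μ q.2 * Real.exp (9 / 4 * B) * ((G q.1 ^ 2 + G q.2 ^ 2) / 2) := by
          gcongr
      _ = D q := by rw [hD]; ring
  calc |gnPairTerm B μ G (σ, σ')| ≤ ∫ q, D q ∂((volume : Measure ZM).prod volume) := by
        unfold gnPairTerm
        refine (abs_integral_le_integral_abs).trans (integral_mono_of_nonneg (ae_of_all _ fun q => abs_nonneg _) hDi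
          (ae_of_all _ fun q => hpt q))
    _ = Real.exp (9 / 4 * B) * ((∫ y, gnDensityReal μ y * G y ^ 2) / 8) := by
        have e2 : (∫ q : ZM × ZM, gnDensityReal μ q.1 * (gnDensityReal μ q.2 * G q.2 ^ 2) ∂((volume : Measure ZM).prod volume)) =
            (1 / 8) * ∫ y, gnDensityReal μ y * G y ^ 2 := by
          rw [integral_prod_mul (f := gnDensityReal μ) (g := fun y => gnDensityReal μ y * G y ^ 2), integral_gnDensityReal hμ]
        rw [hD, integral_const_mul, integral_div, integral_add hI1 hI2, integral_prod_density_sq hμ, e2]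
        ring

/-- **Lower bound by the diagonal**: in the window, `⟨Ψ,K_BΨ⟩ ≥ 8·T_{σ₀σ₀} − 7 e^{9B/4} ∫ρG²`. [folklore] -/
theorem qform_gnPullback_ge (hμ : 0 < μ) (hB : 0 ≤ B) (hG : Measurable G) (hb : ∃ C : ℝ, ∀ x, |G x| ≤ C) (hinv : IsGaugeInv G)
    (hi : Integrable fun y => G y ^ 2) {r : ℝ} (hsupp : ∀ y, G y ≠ 0 → ‖y‖ ≤ r) (hr : μ ^ 2 * r ^ 2 ≤ 1 / 16)
    (σ₀ : Fin 3 → Bool) :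
    8 * gnPairTerm B μ G (σ₀, σ₀) - 7 * Real.exp (9 / 4 * B) * ∫ y, gnDensityReal μ y * G y ^ 2 ≤
      qform su2Rep B (fun U : Cfg => G (gnCoord μ U)) (fun U => G (gnCoord μ U)) := by
  rw [qform_gnPullback_eq_sum hμ hB hG hb hinv, Fintype.sum_prod_type]
  -- split each inner sum into the diagonal term and the rest
  have hsplit : ∀ σ : Fin 3 → Bool, ∑ σ', gnPairTerm B μ G (σ, σ') =
      gnPairTerm B μ G (σ₀, σ₀) + ∑ σ' ∈ Finset.univ.erase σ, gnPairTerm B μ G (σ, σ') := by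
    intro σ
    rw [← Finset.add_sum_erase _ _ (Finset.mem_univ σ), gnPairTerm_diag_eq B μ G σ σ₀]
  simp_rw [hsplit]
  rw [Finset.sum_add_distrib, Finset.sum_const, Finset.card_univ]
  have hcard : Fintype.card (Fin 3 → Bool) = 8 := by simp
  rw [hcard]
  have hoff : ∀ σ : Fin 3 → Bool, -(7 * (Real.exp (9 / 4 * B) * ((∫ y, gnDensityReal μ y * G y ^ 2) / 8))) ≤
      ∑ σ' ∈ Finset.univ.erase σ, gnPairTerm B μ G (σ, σ') := by
    intro σ
    have h7 : (Finset.univ.erase σ).card = 7 := by rw [Finset.card_erase_of_mem (Finset.mem_univ σ), Finset.card_univ, hcard]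
    calc -(7 * (Real.exp (9 / 4 * B) * ((∫ y, gnDensityReal μ y * G y ^ 2) / 8)))
        = ∑ _σ' ∈ Finset.univ.erase σ, -(Real.exp (9 / 4 * B) * ((∫ y, gnDensityReal μ y * G y ^ 2) / 8)) := by
          rw [Finset.sum_const, h7]; simp
      _ ≤ ∑ σ' ∈ Finset.univ.erase σ, gnPairTerm B μ G (σ, σ') := Finset.sum_le_sum fun σ' hσ' => by
          have hne : σ ≠ σ' := fun h => (Finset.ne_of_mem_erase hσ') h.symm
          have := abs_gnPairTerm_offdiag_le hμ hB hG hi hsupp hr hne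
          linarith [neg_abs_le (gnPairTerm B μ G (σ, σ'))]
  have htot := Finset.sum_le_sum fun σ (_ : σ ∈ (Finset.univ : Finset (Fin 3 → Bool))) => hoff σ
  rw [Finset.sum_const, Finset.card_univ, hcard] at htot
  simp only [nsmul_eq_mul, Nat.cast_ofNat] at htot ⊢
  linarith

end QForm

end Summit.QuantumFields.YangMills.Theorems.FemtoTransferGap

end
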